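import Literature.NumberTheory.EllipticCurves.BinaryQuarticOrbitWeightsIntegralProofs
import HarnessLib

/-!
# The mass identity behind Bhargava–Shankar's Cor. 3.8:
# `Σ_{f' ∈ B(f)} 1 / (m(f') · #Aut_R(f')) = 1 / #Aut_K(f)`

`Proofs` companion (theorems only: no definitions, no named facts) of `BinaryQuarticOrbitWeights.lean`.
Source: M. Bhargava, A. Shankar, *Binary quartic forms having bounded invariants, and the
boundedness of the average rank of elliptic curves*, Ann. of Math. (2) 181 (2015) 191–242, §3.2–3.4
of the published version (= `arXiv:1006.1002v3`): counting `PGL₂(ℤ_p)`-orbits (resp. integrating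
over `V_{ℤ_p}`) with the weight `1/m_p` and dividing by the integral stabilisers produces, class by
class, the weight `1/#Aut_{ℚ_p}(f)` of the `PGL₂(ℚ_p)`-class (Prop. 3.7, Cor. 3.8: the integrand
`Σ_{f ∈ V_{ℤ_p}(I,J)/PGL₂(ℚ_p)} 1/#Aut_{ℚ_p}(f)`, which Lemmas 5.10–5.11 / Thm 3.2 turn into
`#(E/2E)/#E[2]`, `BhargavaShankarLocalOrbitMass.lean`). The underlying algebraic identity — spelled
out as eq. (39) of A. Shankar, X. Wang, arXiv:1307.3531 (proof of their Thm 4.15):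
`Σᵢ w(Bᵢ)/#Stab_{G(ℤ)}(Bᵢ) = 1/#Stab_{G(ℚ)}(B)` for the orbits `Bᵢ` in the class of `B` and
`w = 1/m` — is proved here for the tree's weights, over any `R → K`:

* `BinaryQuartic.pgl2StabilizerCard_smul`: `#Aut_K` is a class function;
* `BinaryQuartic.finsum_autIndex_div_eq_one`: `Σ_{O ∈ B(f)} [Aut_K(f_O) : Aut_R(f_O)] / m(f) = 1`;
* `BinaryQuartic.finsum_inv_weight_mul_autIntCard`:
  **`Σ_{O ∈ B(f)} 1/(m(f_O) · #Aut_R(f_O)) = 1/#Aut_K(f)`** for any representatives `f_O ∈ O`,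
  whenever the coset set of `f` is finite and `#Aut_K(f)` is finite (nonzero) — e.g. `Δ(f) ≠ 0`
  over `ℚ` or `ℚ_p` (`cosets_int_finite_and_ncard_eq`, `cosets_padic_finite`, Lemma 5.11).

## References

* M. Bhargava, A. Shankar, Ann. of Math. (2) 181 (2015) 191–242, §3.2 and Cor. 3.8 of the published
  version. [cite: BhargavaShankarAnnals2015, §3.2 and Cor. 3.8 (published numbering)]
* A. Shankar, X. Wang, Compos. Math. 154 (2018) = arXiv:1307.3531, eq. (39).
-/

noncomputable section

open scoped Classical
open Matrix MulAction Literature.GroupTheory.Index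

namespace Literature.NumberTheory.EllipticCurves

namespace BinaryQuartic

variable {K : Type*} [Field K] {R : Type*} [CommRing R] (φ : R →+* K)

/-- **`#Aut_K` is a class function**: `#Stab_{PGL₂(K)}(g · f) = #Stab_{PGL₂(K)}(f)` (conjugate
stabilisers). [cite: BhargavaShankarAnnals2015, §3.2 (#Aut_ℚ(f′) = #Aut_ℚ(f); published numbering)] -/
theorem pgl2StabilizerCard_smul (g : GL (Fin 2) K) (f : BinaryQuartic K) :
    pgl2StabilizerCard (g • f) = pgl2StabilizerCard f := by
  rw [← relIndex_center_stabilizer, ← relIndex_center_stabilizer, stabilizer_smul_eq_stabilizer_map_conj]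
  set ψ : GL (Fin 2) K →* GL (Fin 2) K := (MulAut.conj g).toMonoidHom
  have hinj : Function.Injective ψ := (MulAut.conj g).injective
  have hZ : (Subgroup.center (GL (Fin 2) K)).map ψ = Subgroup.center (GL (Fin 2) K) := by
    ext z
    constructor
    · rintro ⟨z', hz', rfl⟩
      have hz'' : z' ∈ Subgroup.center (GL (Fin 2) K) := hz'
      rw [Subgroup.mem_center_iff] at hz'' ⊢
      intro h
      simp only [ψ, MulEquiv.coe_toMonoidHom, MulAut.conj_apply]
      have hc := hz'' (g⁻¹ * h * g)
      calc h * (g * z' * g⁻¹) = g * ((g⁻¹ * h * g) * z') * g⁻¹ := by group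
        _ = g * (z' * (g⁻¹ * h * g)) * g⁻¹ := by rw [hc]
        _ = g * z' * g⁻¹ * h := by group
    · intro hz
      refine ⟨z, hz, ?_⟩
      simp only [ψ, MulEquiv.coe_toMonoidHom, MulAut.conj_apply]
      rw [Subgroup.mem_center_iff.mp hz g, mul_inv_cancel_right]
  conv_rhs => rw [← Subgroup.relIndex_map_map_of_injective (f := ψ) _ _ hinj, hZ]

/-- `#Aut_K` is constant on the `PGL₂(K)`-class: for `f'` in the orbit of `f`. [folklore] -/
theorem pgl2StabilizerCard_eq_of_mem_orbit {f f' : BinaryQuartic K} (h : f' ∈ orbit (GL (Fin 2) K) f) :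
    pgl2StabilizerCard f' = pgl2StabilizerCard f := by
  obtain ⟨g, rfl⟩ := h
  exact pgl2StabilizerCard_smul g f

/-- Elements of the orbits `O ∈ B(f)` lie in the class of `f` and are integral. [folklore] -/
theorem mem_orbit_of_mem_intClassOrbits {f : BinaryQuartic K} {O : Set (BinaryQuartic K)}
    (hO : O ∈ intClassOrbits φ f) {f' : BinaryQuartic K} (hf' : f' ∈ O) :
    f' ∈ orbit (GL (Fin 2) K) f ∧ f' ∈ integralForms φ := by
  obtain ⟨y, ⟨hy, hyint⟩, rfl⟩ := (mem_intClassOrbits_iff φ f O).mp hO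
  obtain ⟨γ, rfl⟩ := mem_orbit_iff.mp hf'
  refine ⟨?_, smul_mem_integralForms φ γ.2 hyint⟩
  obtain ⟨g, rfl⟩ := hy
  rw [Subgroup.smul_def, smul_smul]
  exact mem_orbit _ _

/-- **`Σ_{O ∈ B(f)} [Aut_K(f_O) : Aut_R(f_O)] = m(f)` in `ℚ`**, for representatives `f_O ∈ O` and a
finite set of orbits. [cite: BhargavaShankarAnnals2015, §3.2 (published numbering)] -/
theorem cast_weight_eq_sum_autIndex (f : BinaryQuartic K) (hOfin : (intClassOrbits φ f).Finite)
    {r : Set (BinaryQuartic K) → BinaryQuartic K} (hr : ∀ O ∈ intClassOrbits φ f, r O ∈ O) :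
    (weight φ f : ℚ) = ∑ O ∈ hOfin.toFinset, (autIndex φ (r O) : ℚ) := by
  rw [weight_eq_finsum_of_representatives φ f hr, finsum_mem_eq_finite_toFinset_sum _ hOfin, Nat.cast_sum]

/-- **The mass identity**: for representatives `f_O ∈ O` of the orbits `O ∈ B(f)` (assumed to
exist, e.g. `f` integral), `Σ_O 1/(m(f_O) · #Aut_R(f_O)) = 1/#Aut_K(f)`, provided the coset set of
`f` is finite and `#Aut_K(f) ≠ 0` (finite stabiliser). Indeed `m(f_O) = m(f)`,
`#Aut_K(f_O) = #Aut_K(f)`, `[Aut_K(f_O) : Aut_R(f_O)] · #Aut_R(f_O) = #Aut_K(f_O)` and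
`Σ_O [Aut_K(f_O) : Aut_R(f_O)] = m(f)`. [cite: BhargavaShankarAnnals2015, Cor. 3.8 (published numbering)] -/
theorem finsum_inv_weight_mul_autIntCard (f : BinaryQuartic K) (hfin : (cosets φ f).Finite)
    (hne : (intClassOrbits φ f).Nonempty) (hS : pgl2StabilizerCard f ≠ 0)
    {r : Set (BinaryQuartic K) → BinaryQuartic K} (hr : ∀ O ∈ intClassOrbits φ f, r O ∈ O) :
    ∑ᶠ O ∈ intClassOrbits φ f, (1 : ℚ) / ((weight φ (r O) : ℚ) * autIntCard φ (r O)) =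
      1 / pgl2StabilizerCard f := by
  have hOfin : (intClassOrbits φ f).Finite := finite_orbitsIn_of_finite hfin
  have hw : ∀ O ∈ intClassOrbits φ f, weight φ (r O) = weight φ f := fun O hO ↦ by
    obtain ⟨g, hg⟩ := (mem_orbit_of_mem_intClassOrbits φ hO (hr O hO)).1
    rw [← hg]; exact weight_smul φ g f
  have hSt : ∀ O ∈ intClassOrbits φ f, pgl2StabilizerCard (r O) = pgl2StabilizerCard f := fun O hO ↦
    pgl2StabilizerCard_eq_of_mem_orbit (mem_orbit_of_mem_intClassOrbits φ hO (hr O hO)).1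
  -- `m(f) ≥ 1`
  have hwpos : (weight φ f : ℚ) ≠ 0 := by
    have h1 : 1 ≤ (intClassOrbits φ f).ncard := (Set.ncard_pos hOfin).mpr hne
    have h2 := ncard_intClassOrbits_le_weight φ f hfin
    exact_mod_cast (Nat.one_le_iff_ne_zero.mp (h1.trans h2))
  have hSq : (pgl2StabilizerCard f : ℚ) ≠ 0 := Nat.cast_ne_zero.mpr hS
  -- each term equals `[Aut_K : Aut_R](f_O) / (m(f) · #Aut_K(f))`
  have hterm : ∀ O ∈ intClassOrbits φ f, (1 : ℚ) / ((weight φ (r O) : ℚ) * autIntCard φ (r O)) =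
      (autIndex φ (r O) : ℚ) / ((weight φ f : ℚ) * pgl2StabilizerCard f) := fun O hO ↦ by
    have hprod : (autIndex φ (r O) : ℚ) * autIntCard φ (r O) = pgl2StabilizerCard f := by
      rw [← hSt O hO, ← autIndex_mul_autIntCard φ (r O), Nat.cast_mul]
    have hA : (autIntCard φ (r O) : ℚ) ≠ 0 := by
      intro h0; rw [h0, mul_zero] at hprod; exact hSq hprod.symm
    rw [hw O hO, div_eq_div_iff (mul_ne_zero hwpos hA) (mul_ne_zero hwpos hSq), one_mul, ← hprod]
    ring
  rw [finsum_mem_congr rfl hterm, finsum_mem_eq_finite_toFinset_sum _ hOfin, ← Finset.sum_div]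
  have hsum : ∑ O ∈ hOfin.toFinset, (autIndex φ (r O) : ℚ) = weight φ f := by
    rw [cast_weight_eq_sum_autIndex φ f hOfin hr]
  rw [hsum, div_mul_eq_div_div, div_self hwpos]

/-- The same over `ℚ_p` for `f ∈ V_{ℤ_p}` with `Δ(f) ≠ 0` and finite `#Aut_{ℚ_p}(f)`:
`Σ_{O ∈ B_p(f)} 1/(m_p(f_O) · #Aut_{ℤ_p}(f_O)) = 1/#Aut_{ℚ_p}(f)`. [cite: BhargavaShankarAnnals2015, Cor. 3.8 (published numbering)] -/
theorem finsum_inv_localWeight_mul_autIntCard {p : ℕ} [Fact p.Prime] (f : BinaryQuartic ℤ_[p]) (hΔ : f.disc ≠ 0)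
    (hS : pgl2StabilizerCard (f.map PadicInt.Coe.ringHom) ≠ 0)
    {r : Set (BinaryQuartic ℚ_[p]) → BinaryQuartic ℚ_[p]}
    (hr : ∀ O ∈ intClassOrbits (PadicInt.Coe.ringHom (p := p)) (f.map PadicInt.Coe.ringHom), r O ∈ O) :
    ∑ᶠ O ∈ intClassOrbits (PadicInt.Coe.ringHom (p := p)) (f.map PadicInt.Coe.ringHom),
        (1 : ℚ) / ((weight (PadicInt.Coe.ringHom (p := p)) (r O) : ℚ) * autIntCard (PadicInt.Coe.ringHom (p := p)) (r O)) =
      1 / pgl2StabilizerCard (f.map PadicInt.Coe.ringHom) :=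
  finsum_inv_weight_mul_autIntCard _ _ (cosets_padic_finite f hΔ)
    ⟨_, (mem_intClassOrbits_iff _ _ _).mpr ⟨f.map PadicInt.Coe.ringHom, ⟨mem_orbit_self _, map_mem_integralForms _ f⟩, rfl⟩⟩
    hS hr

end BinaryQuartic

end Literature.NumberTheory.EllipticCurves

end
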